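import Summits.HodgeConjecture.HodgeConjecture.Theses.EndoscopicMiddleDegree
import Summits.HodgeConjecture.HodgeConjecture.Theorems.IsotypicMiddleClassesAlgebraic.Negative.LoadBearing
import Literature.AlgebraicGeometry.HodgeTheory.ComplexGysinCorrespondence
import Literature.AlgebraicGeometry.HodgeTheory.MotivatedClassesAlgebraic
import Literature.AlgebraicGeometry.HodgeTheory.GysinKernelProofs
import Literature.AlgebraicGeometry.Motives.VarietiesProjectiveSpaceProofs
import Literature.AlgebraicGeometry.Motives.VarietiesUnitProofs
import Literature.AlgebraicGeometry.Motives.SegreEmbedding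

/-!
# `AlgebraicOrEnveloped` (stmt-HodgeConjecture-14943) · Negative · calibration of the dichotomy

Negative knowledge for the crux `EndoscopicMiddleDegree.AlgebraicOrEnveloped` (route
EndoscopicMiddleDegree, rev 11, rank 5; the DICHOTOMY: on a compact ball quotient `X` of dimension
`2n = 2(m+1)`, `m ∈ {1,2}`, with HC in degree `2m`, every rational Hodge `(n,n)`-class lies in
`algebraicClasses X n ⊔ span_ℂ {e rational : ∃ μ, ∃ γ algebraic, P_γ preserves rational classes, has
(n,n) image, P_γ e = e}`, `P_γ β = pr₁₊(pr₂^* β ∪ γ)`), kernel-checked, by the standing disprover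
(refuter-cdisprove-stmt-HodgeConjecture-14943-0, cdisprove cycle 1, 2026-08-16; work file
`Cruxes/AlgebraicOrEnveloped/Disproof.lean`).

1. CEILING (`not_middleDegreeStep_of_not_crux`, `not_middleHC_of_not_crux`,
   `not_hodgeConjecture_of_not_crux`, `not_split_of_not_crux`): the crux is implied by the target
   `MiddleDegreeStep` through `Submodule.mem_sup_left` alone — no exterior square, no Hodge–Riemann —
   hence by the Hodge conjecture; a refutation of the crux is a non-algebraic rational Hodge class on a
   compact arithmetic `4`- or `6`-ball quotient. By the glue `AlgebraicOrEnvelopedOfSplit` (proved,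
   `algebraicOrEnvelopedOfSplit_proof`) it would also refute one of `CupProductAlgebraic`,
   `OrthogonalSplit`, `OrthogonalEnveloped`.
2. BARE FORM (`bareForm_holds`): if the span generators may use ARBITRARY maps `P` with the three
   properties (not only correspondence actions of algebraic classes), the statement is a triviality
   (`P ≡ c`): all content of the crux is the shape `P = [γ]_*`, `γ` algebraic.
3. WITHOUT THE `(n,n)`-IMAGE CLAUSE the crux is a THEOREM (`withoutHodgeImage_holds`): the diagonal
   `[Δ_X] = (𝟙,𝟙)_* 1` is algebraic and acts as the identity (sibling lemma `corrAction_diagonal_apply`),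
   so every rational class is enveloped. The purity clause is the whole content of the envelope.
4. THE `∃ μ` SLACK IS VOID (`enveloped_of_enveloped`, `setOf_enveloped_eq`): `corrAction μ' = c •
   corrAction μ`, `c ≠ 0` (`corrAction_eq_smul_of_orientationFamily`) and `γ ↦ c • γ` preserves
   `algebraicClasses`, so the generator set of the crux equals the one at ANY fixed family `μ₀`
   (Poincaré duality being the theorem `OrientationFamily.hasPoincareDuality`); provers may fix `μ₀`.
5. LINE `Sketch` (idea hull-gysin-dichotomy), RETRACT HULLS (`eq_zero_of_complexGysin_eq_zero_of_retract`,
   `shadowKernel_eq_zero_of_admissible_retract`, `shadowKernel_eq_zero_of_hodgeConjecture`): the typed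
   shadow-kernel condition `∀ admissible 3n-fold hull (X', ι), ι_* e = 0` quantifies over the retract
   hull `X ⊗ ℙⁿ ⊇ X × {pt}`, on which `ι_*` is injective (`pr₁₊ ι₊ = id`); its admissibility is a case of
   HC, so under HC the shadow kernel is `0` and the bet `ShadowKernelEnveloped` is vacuous (true by
   `γ = 0`), never false: no stub of the line is refutable short of `¬HC` either.

No hypothesis beyond the theorems' explicit ones; no `def`; axioms `propext`, `Classical.choice`,
`Quot.sound`.

## References

* [Deligne2000] P. Deligne, The Hodge conjecture, Clay Mathematics Institute (2000), §1.
* [VoisinHodgeII2003] C. Voisin, Hodge Theory and Complex Algebraic Geometry II, CUP 2003, proof of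
  Thm. 10.17 (10.7), Prop. 9.20.
* [FultonYoungTableaux1997] W. Fulton, Young Tableaux, CUP 1997, App. B §B.1 (2), (5), (6).
* [Fulton1998] W. Fulton, Intersection Theory, 2nd ed. 1998, §16.1 Prop. 16.1.1, Ex. 16.1.3.
* [BergeronMillsonMoeglin2016Balls] N. Bergeron, J. Millson, C. Moeglin, arXiv:1306.1515, Cor. 1.4
  (p. 3: `n ∈ [0,p] ∖ ]p/3, 2p/3[`).
-/

noncomputable section

-- The mandated namespace `Summit.<P>.<Sub>.Theorems.…` repeats `HodgeConjecture` (single-conjunct summit).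
set_option linter.dupNamespace false

namespace Summit.HodgeConjecture.HodgeConjecture.Theorems.AlgebraicOrEnveloped.Negative.Calibration

open CategoryTheory MonoidalCategory CartesianMonoidalCategory
open Literature.AlgebraicGeometry Literature.AlgebraicGeometry.Motives
  Literature.AlgebraicGeometry.HodgeTheory Literature.AlgebraicGeometry.ShimuraVarieties
  Literature.AlgebraicTopology.SingularHomology
open Summit.HodgeConjecture.HodgeConjecture.Theses.EndoscopicMiddleDegree
  (AlgebraicOrEnveloped MiddleDegreeStep OrthogonalEnveloped OrthogonalSplit CupProductAlgebraic
    AlgebraicOrEnvelopedOfSplit)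
open Summit.HodgeConjecture.HodgeConjecture.Theorems.IsotypicMiddleClassesAlgebraic.Negative.LoadBearing
  (corrAction_diagonal_apply)

variable {m : ℕ} {X : SchemeOver ℂ}

/-! ### 1. Ceiling: no kill short of the target, hence short of HC -/

/-- **Ceiling.** If the crux fails, the target `MiddleDegreeStep` fails: the crux's conclusion
`c ∈ algebraicClasses X (m+1) ⊔ span {enveloped}` follows from `c ∈ algebraicClasses X (m+1)` by
`Submodule.mem_sup_left`. [folklore] -/
theorem not_middleDegreeStep_of_not_crux (h : ¬ AlgebraicOrEnveloped) : ¬ MiddleDegreeStep := by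
  intro hM
  exact h fun m X D hm1 hm2 hlow c hc hH ↦ Submodule.mem_sup_left (hM m X hm1 hm2 ⟨D⟩ hlow c hc hH)

/-- **Ceiling, sector form.** If the crux fails, some compact arithmetic `2(m+1)`-ball quotient,
`m ∈ {1,2}`, carries a rational `(m+1,m+1)`-class that is not algebraic (the degree-`2m` hypothesis of
the crux is not even needed for this). [folklore] -/
theorem not_middleHC_of_not_crux (h : ¬ AlgebraicOrEnveloped) :
    ¬ ∀ (m : ℕ) (X : SchemeOver ℂ), UnitaryBallQuotientDatum (2 * (m + 1)) X → 1 ≤ m →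
      m ≤ 2 → ∀ c : complexBetti X (2 * (m + 1)), IsRationalClass c →
        IsOfHodgeType (2 * (m + 1)) X (2 * (m + 1)) (m + 1) (m + 1) c →
          c ∈ algebraicClasses X (m + 1) := by
  intro hM
  exact h fun m X D hm1 hm2 _ c hc hH ↦ Submodule.mem_sup_left (hM m X D hm1 hm2 c hc hH)

/-- **Ceiling.** If the crux fails, the Hodge conjecture fails (`X` is smooth projective of dimension
`2(m+1)` by the datum). [cite: Deligne2000, §1] -/
theorem not_hodgeConjecture_of_not_crux (h : ¬ AlgebraicOrEnveloped) : ¬ _root_.HodgeConjecture := by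
  intro hHC
  exact not_middleHC_of_not_crux h fun m _ D _ _ c hc hH ↦ (hHC D.isSmoothProjective).2 (m + 1) c hc hH

/-- **Where a kill would propagate inside the route**: by the glue `AlgebraicOrEnvelopedOfSplit`
(PROVED: `Theorems.algebraicOrEnvelopedOfSplit_proof`, item stmt-HodgeConjecture-14944; taken as a
hypothesis here only to keep this file's import cone small), a refutation of the crux refutes
`CupProductAlgebraic` (Fulton 19.2), `OrthogonalSplit` (Hodge–Riemann) or `OrthogonalEnveloped` (the
automorphic heart). [folklore] -/
theorem not_split_of_not_crux (h : ¬ AlgebraicOrEnveloped) (hglue : AlgebraicOrEnvelopedOfSplit) :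
    ¬ CupProductAlgebraic ∨ ¬ OrthogonalSplit ∨ ¬ OrthogonalEnveloped := by
  by_contra hcon
  simp only [not_or, not_not] at hcon
  exact h (hglue hcon.1 hcon.2.1 hcon.2.2)

/-! ### 2. Bare form: all content is in the shape `P = [γ]_*` -/

/-- **Bare form is a triviality.** If the span generators of the crux may use an ARBITRARY map
`P : H^{2n} → H^{2n}` preserving rational classes, with `(n,n)` values and fixing `e` (instead of the
action of an algebraic class), then every rational `(n,n)`-class `c` is itself a generator (`P ≡ c`),
for every `m` and without the degree-`2m` hypothesis. [folklore] -/
theorem bareForm_holds (m : ℕ) (X : SchemeOver ℂ) (c : complexBetti X (2 * (m + 1)))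
    (hc : IsRationalClass c) (hH : IsOfHodgeType (2 * (m + 1)) X (2 * (m + 1)) (m + 1) (m + 1) c) :
    c ∈ algebraicClasses X (m + 1) ⊔ Submodule.span ℂ {e : complexBetti X (2 * (m + 1)) |
      IsRationalClass e ∧ ∃ P : complexBetti X (2 * (m + 1)) → complexBetti X (2 * (m + 1)),
        (∀ β, IsRationalClass β → IsRationalClass (P β)) ∧
        (∀ β, IsOfHodgeType (2 * (m + 1)) X (2 * (m + 1)) (m + 1) (m + 1) (P β)) ∧ P e = e} :=
  Submodule.mem_sup_right (Submodule.subset_span ⟨hc, fun _ ↦ c, fun _ _ ↦ hc, fun _ ↦ hH, rfl⟩)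

/-! ### 3. Without the `(n,n)`-image clause the crux is a theorem -/

/-- **Without the purity clause every rational class is enveloped**: for `X` smooth projective of
dimension `2(m+1)` and every orientation family `μ`, the diagonal class `[Δ_X] = (𝟙, 𝟙)_* 1 ∈
algebraicClasses (X ⊗ X) (2(m+1))` acts as the identity, preserves rational classes and fixes `c`.
(The crux's inline `P` is the tree's `corrAction μ hX hX rfl γ`, by `rfl`.)
[cite: Fulton1998, §16.1 Ex. 16.1.3] [cite: VoisinHodgeII2003, proof of Thm. 10.17 (10.7)] -/
theorem exists_diagonal_envelope (μ : OrientationFamily) (hX : IsSmoothProjective (2 * (m + 1)) X)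
    (c : complexBetti X (2 * (m + 1))) :
    ∃ γ ∈ algebraicClasses (X ⊗ X) (2 * (m + 1)),
      (∀ β, IsRationalClass β → IsRationalClass
        (corrAction μ hX hX
          (rfl : 2 * (m + 1) + 2 * (2 * (m + 1)) = 2 * (m + 1) + 2 * (2 * (m + 1))) γ β)) ∧
      corrAction μ hX hX
        (rfl : 2 * (m + 1) + 2 * (2 * (m + 1)) = 2 * (m + 1) + 2 * (2 * (m + 1))) γ c = c := by
  refine ⟨_, complexGysin_graph_one_mem_algebraicClasses μ μ.hasPoincareDuality hX
    (IsSmoothProjective.tensor_holds hX hX) (𝟙 X), fun β hβ ↦ ?_, ?_⟩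
  · rwa [corrAction_diagonal_apply μ hX (by omega)]
  · rw [corrAction_diagonal_apply μ hX (by omega)]

/-- **The crux WITHOUT the clause "`P` has purely `(n,n)` image" holds outright** (same binders,
same inline `P`, the clause deleted): `c` is rational, hence itself a generator of the span, enveloped
by the diagonal. So the purity of the image of `P_γ` is the entire content of the envelope; the
degree-`2m` hypothesis, `1 ≤ m ≤ 2`, the datum beyond `isSmoothProjective` and the Hodge type of `c`
are not used. [cite: Fulton1998, §16.1 Ex. 16.1.3] -/
theorem withoutHodgeImage_holds (m : ℕ) (X : SchemeOver ℂ)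
    (D : UnitaryBallQuotientDatum (2 * (m + 1)) X) (c : complexBetti X (2 * (m + 1)))
    (hc : IsRationalClass c) :
    c ∈ algebraicClasses X (m + 1) ⊔ Submodule.span ℂ {e : complexBetti X (2 * (m + 1)) |
      IsRationalClass e ∧ ∃ μ : OrientationFamily, μ.HasPoincareDuality ∧
        ∃ γ ∈ algebraicClasses (X ⊗ X) (2 * (m + 1)),
          let P : complexBetti X (2 * (m + 1)) → complexBetti X (2 * (m + 1)) := fun β =>
            complexGysin μ (IsSmoothProjective.tensor_holds D.isSmoothProjective D.isSmoothProjective)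
              D.isSmoothProjective (fst X X)
              (show 2 * (m + 1) + 2 * (2 * (m + 1)) + 2 * (2 * (m + 1)) =
                2 * (m + 1) + 2 * (2 * (m + 1) + 2 * (m + 1)) by ring)
              (cupProduct (rfl : 2 * (m + 1) + 2 * (2 * (m + 1)) = 2 * (m + 1) + 2 * (2 * (m + 1)))
                (complexBetti.map (snd X X) (2 * (m + 1)) β) γ)
          (∀ β, IsRationalClass β → IsRationalClass (P β)) ∧ P e = e} := by
  set μ : OrientationFamily := fun _ _ h ↦ Classical.choice (ComplexPoints.isOrientableOver ℂ h)
  obtain ⟨γ, hγ, hrat, hfix⟩ := exists_diagonal_envelope μ D.isSmoothProjective c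
  exact Submodule.mem_sup_right (Submodule.subset_span ⟨hc, μ, μ.hasPoincareDuality, γ, hγ, hrat, hfix⟩)

/-! ### 4. The `∃ μ` slack is void -/

/-- **Envelopes transfer between orientation families.** For `X` smooth projective of dimension
`2(m+1)` and two orientation families `μ`, `μ'`: if some algebraic `γ` envelopes `e` for `μ`
(rationality preservation, `(n,n)` image, `P_γ e = e`), then `c • γ` does for `μ'`, where
`corrAction μ = c • corrAction μ'`, `c ≠ 0`. [cite: FultonYoungTableaux1997, Appendix B §B.1 (5)] -/
theorem enveloped_of_enveloped (μ μ' : OrientationFamily) (hX : IsSmoothProjective (2 * (m + 1)) X)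
    {e : complexBetti X (2 * (m + 1))}
    (h : ∃ γ ∈ algebraicClasses (X ⊗ X) (2 * (m + 1)),
      (∀ β, IsRationalClass β → IsRationalClass
        (corrAction μ hX hX
          (rfl : 2 * (m + 1) + 2 * (2 * (m + 1)) = 2 * (m + 1) + 2 * (2 * (m + 1))) γ β)) ∧
      (∀ β, IsOfHodgeType (2 * (m + 1)) X (2 * (m + 1)) (m + 1) (m + 1)
        (corrAction μ hX hX
          (rfl : 2 * (m + 1) + 2 * (2 * (m + 1)) = 2 * (m + 1) + 2 * (2 * (m + 1))) γ β)) ∧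
      corrAction μ hX hX
        (rfl : 2 * (m + 1) + 2 * (2 * (m + 1)) = 2 * (m + 1) + 2 * (2 * (m + 1))) γ e = e) :
    ∃ γ ∈ algebraicClasses (X ⊗ X) (2 * (m + 1)),
      (∀ β, IsRationalClass β → IsRationalClass
        (corrAction μ' hX hX
          (rfl : 2 * (m + 1) + 2 * (2 * (m + 1)) = 2 * (m + 1) + 2 * (2 * (m + 1))) γ β)) ∧
      (∀ β, IsOfHodgeType (2 * (m + 1)) X (2 * (m + 1)) (m + 1) (m + 1)
        (corrAction μ' hX hX
          (rfl : 2 * (m + 1) + 2 * (2 * (m + 1)) = 2 * (m + 1) + 2 * (2 * (m + 1))) γ β)) ∧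
      corrAction μ' hX hX
        (rfl : 2 * (m + 1) + 2 * (2 * (m + 1)) = 2 * (m + 1) + 2 * (2 * (m + 1))) γ e = e := by
  obtain ⟨γ, hγ, hrat, hhodge, hfix⟩ := h
  obtain ⟨c, _, hc⟩ := corrAction_eq_smul_of_orientationFamily μ'.hasPoincareDuality
    μ.hasPoincareDuality hX hX
    (rfl : 2 * (m + 1) + 2 * (2 * (m + 1)) = 2 * (m + 1) + 2 * (2 * (m + 1)))
  have key : ∀ β, corrAction μ' hX hX
      (rfl : 2 * (m + 1) + 2 * (2 * (m + 1)) = 2 * (m + 1) + 2 * (2 * (m + 1))) (c • γ) β =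
      corrAction μ hX hX
        (rfl : 2 * (m + 1) + 2 * (2 * (m + 1)) = 2 * (m + 1) + 2 * (2 * (m + 1))) γ β := by
    intro β
    rw [map_smul, LinearMap.smul_apply, hc, LinearMap.smul_apply, LinearMap.smul_apply]
  refine ⟨c • γ, Submodule.smul_mem _ _ hγ, fun β hβ ↦ ?_, fun β ↦ ?_, ?_⟩
  · rw [key]; exact hrat β hβ
  · rw [key]; exact hhodge β
  · rw [key]; exact hfix

/-- **The generator set of the crux does not depend on the orientation family**: the set
`{e rational | ∃ μ with Poincaré duality, ∃ γ algebraic enveloping e for μ}` of the crux (inline `P`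
unfolded to `corrAction`, by `rfl`) equals, for ANY fixed family `μ₀`, the set of rational classes
enveloped for `μ₀`. Provers may therefore fix the family (e.g. a rationally normalised one).
[cite: FultonYoungTableaux1997, Appendix B §B.1 (5)] -/
theorem setOf_enveloped_eq (μ₀ : OrientationFamily) (hX : IsSmoothProjective (2 * (m + 1)) X) :
    {e : complexBetti X (2 * (m + 1)) | IsRationalClass e ∧ ∃ μ : OrientationFamily,
      μ.HasPoincareDuality ∧ ∃ γ ∈ algebraicClasses (X ⊗ X) (2 * (m + 1)),
        (∀ β, IsRationalClass β → IsRationalClass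
          (corrAction μ hX hX
            (rfl : 2 * (m + 1) + 2 * (2 * (m + 1)) = 2 * (m + 1) + 2 * (2 * (m + 1))) γ β)) ∧
        (∀ β, IsOfHodgeType (2 * (m + 1)) X (2 * (m + 1)) (m + 1) (m + 1)
          (corrAction μ hX hX
            (rfl : 2 * (m + 1) + 2 * (2 * (m + 1)) = 2 * (m + 1) + 2 * (2 * (m + 1))) γ β)) ∧
        corrAction μ hX hX
          (rfl : 2 * (m + 1) + 2 * (2 * (m + 1)) = 2 * (m + 1) + 2 * (2 * (m + 1))) γ e = e} =
    {e : complexBetti X (2 * (m + 1)) | IsRationalClass e ∧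
      ∃ γ ∈ algebraicClasses (X ⊗ X) (2 * (m + 1)),
        (∀ β, IsRationalClass β → IsRationalClass
          (corrAction μ₀ hX hX
            (rfl : 2 * (m + 1) + 2 * (2 * (m + 1)) = 2 * (m + 1) + 2 * (2 * (m + 1))) γ β)) ∧
        (∀ β, IsOfHodgeType (2 * (m + 1)) X (2 * (m + 1)) (m + 1) (m + 1)
          (corrAction μ₀ hX hX
            (rfl : 2 * (m + 1) + 2 * (2 * (m + 1)) = 2 * (m + 1) + 2 * (2 * (m + 1))) γ β)) ∧
        corrAction μ₀ hX hX
          (rfl : 2 * (m + 1) + 2 * (2 * (m + 1)) = 2 * (m + 1) + 2 * (2 * (m + 1))) γ e = e} := by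
  ext e
  simp only [Set.mem_setOf_eq]
  constructor
  · rintro ⟨he, μ, -, h⟩
    exact ⟨he, enveloped_of_enveloped μ μ₀ hX h⟩
  · rintro ⟨he, h⟩
    exact ⟨he, μ₀, μ₀.hasPoincareDuality, h⟩

/-- The crux is literally its `corrAction` spelling (the inline `let P := …` is
`corrAction μ D.isSmoothProjective D.isSmoothProjective rfl γ` definitionally), recorded as the
failure-transfer provers and refuters may quote. [folklore] -/
theorem not_corrActionForm_of_not_crux (h : ¬ AlgebraicOrEnveloped) :
    ¬ ∀ (m : ℕ) (X : SchemeOver ℂ) (D : UnitaryBallQuotientDatum (2 * (m + 1)) X), 1 ≤ m → m ≤ 2 →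
      (∀ a : complexBetti X (2 * m), IsRationalClass a →
        IsOfHodgeType (2 * (m + 1)) X (2 * m) m m a → a ∈ algebraicClasses X m) →
      ∀ c : complexBetti X (2 * (m + 1)), IsRationalClass c →
        IsOfHodgeType (2 * (m + 1)) X (2 * (m + 1)) (m + 1) (m + 1) c →
        c ∈ algebraicClasses X (m + 1) ⊔ Submodule.span ℂ {e : complexBetti X (2 * (m + 1)) |
          IsRationalClass e ∧ ∃ μ : OrientationFamily, μ.HasPoincareDuality ∧
            ∃ γ ∈ algebraicClasses (X ⊗ X) (2 * (m + 1)),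
              (∀ β, IsRationalClass β → IsRationalClass
                (corrAction μ D.isSmoothProjective D.isSmoothProjective
                  (rfl : 2 * (m + 1) + 2 * (2 * (m + 1)) = 2 * (m + 1) + 2 * (2 * (m + 1))) γ β)) ∧
              (∀ β, IsOfHodgeType (2 * (m + 1)) X (2 * (m + 1)) (m + 1) (m + 1)
                (corrAction μ D.isSmoothProjective D.isSmoothProjective
                  (rfl : 2 * (m + 1) + 2 * (2 * (m + 1)) = 2 * (m + 1) + 2 * (2 * (m + 1))) γ β)) ∧
              corrAction μ D.isSmoothProjective D.isSmoothProjective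
                (rfl : 2 * (m + 1) + 2 * (2 * (m + 1)) = 2 * (m + 1) + 2 * (2 * (m + 1))) γ e = e} :=
  h

/-! ### 5. Line `Sketch`: retract hulls kill the shadow kernel -/

/-- **A Gysin morphism with a retraction is injective**: for `ι : X ⟶ X'`, `r : X' ⟶ X` with
`ι ≫ r = 𝟙 X` (smooth projective, any dimensions, any orientation family), `ι_* e = 0 ⟹ e = 0`,
since `r_* ∘ ι_* = (ι ≫ r)_* = (𝟙 X)_* = id` (`complexGysin_comp`, `complexGysin_id`).
[cite: FultonYoungTableaux1997, Appendix B §B.1 (2) and (5)] -/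
theorem eq_zero_of_complexGysin_eq_zero_of_retract (μ : OrientationFamily) {d d' : ℕ}
    {X X' : SchemeOver ℂ} (hX : IsSmoothProjective d X) (hX' : IsSmoothProjective d' X')
    (ι : X ⟶ X') (r : X' ⟶ X) (hιr : ι ≫ r = 𝟙 X) {a b : ℕ} (hab : a + 2 * d' = b + 2 * d)
    {e : complexBetti X a} (he : complexGysin μ hX hX' ι hab e = 0) : e = 0 := by
  have hcomp := complexGysin_comp μ.hasPoincareDuality hX hX' hX ι r hab
    (show b + 2 * d = a + 2 * d' by omega)
  rw [hιr, complexGysin_id μ.hasPoincareDuality hX a] at hcomp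
  have h := LinearMap.congr_fun hcomp e
  rw [LinearMap.id_apply, LinearMap.comp_apply, he, map_zero] at h
  exact h

/-- **An admissible retract hull forces the shadow kernel to vanish.** Let `e ∈ H^{2(m+1)}(X(ℂ); ℂ)`
satisfy the line's shadow-kernel condition (`ι_* e = 0` for every smooth projective `3(m+1)`-fold
`X'` on which rational `(m+1,m+1)`-classes in degree `2(m+1)` are algebraic, and every `ι : X ⟶ X'`;
the hypothesis of stub `stub_shadowKernelEnveloped` verbatim). If ONE such admissible hull retracts
onto `X` (`ι ≫ r = 𝟙 X`), then `e = 0`. [cite: FultonYoungTableaux1997, Appendix B §B.1 (2) and (5)] -/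
theorem shadowKernel_eq_zero_of_admissible_retract (μ : OrientationFamily)
    (hX : IsSmoothProjective (2 * (m + 1)) X) {e : complexBetti X (2 * (m + 1))}
    (hsh : ∀ (X' : SchemeOver ℂ) (hX' : IsSmoothProjective (3 * (m + 1)) X') (ι : X ⟶ X'),
      (∀ a : complexBetti X' (2 * (m + 1)), IsRationalClass a →
        IsOfHodgeType (3 * (m + 1)) X' (2 * (m + 1)) (m + 1) (m + 1) a →
        a ∈ algebraicClasses X' (m + 1)) →
      complexGysin μ hX hX' ι
        (show 2 * (m + 1) + 2 * (3 * (m + 1)) = 2 * (2 * (m + 1)) + 2 * (2 * (m + 1)) by ring) e = 0)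
    (X' : SchemeOver ℂ) (hX' : IsSmoothProjective (3 * (m + 1)) X') (ι : X ⟶ X') (r : X' ⟶ X)
    (hιr : ι ≫ r = 𝟙 X)
    (hHC' : ∀ a : complexBetti X' (2 * (m + 1)), IsRationalClass a →
      IsOfHodgeType (3 * (m + 1)) X' (2 * (m + 1)) (m + 1) (m + 1) a →
      a ∈ algebraicClasses X' (m + 1)) :
    e = 0 :=
  eq_zero_of_complexGysin_eq_zero_of_retract μ hX hX' ι r hιr _ (hsh X' hX' ι hHC')

/-- **The product hull `X ⊗ ℙ^{m+1}` is a smooth projective `3(m+1)`-fold retracting onto `X`**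
(`X × {pt} ⊆ X × ℙ^{m+1}`, `pt` a rational point of `ℙ^{m+1}_ℂ`). [folklore] -/
theorem exists_product_retract (hX : IsSmoothProjective (2 * (m + 1)) X) :
    ∃ (X' : SchemeOver ℂ) (_ : IsSmoothProjective (3 * (m + 1)) X') (ι : X ⟶ X') (r : X' ⟶ X),
      ι ≫ r = 𝟙 X := by
  obtain ⟨y, -⟩ := exists_unit_hom_projectiveSpace_isClosedImmersion (m + 1) ℂ
  have hP : IsSmoothProjective (m + 1) (projectiveSpace (m + 1) ℂ) :=
    isSmoothProjective_projectiveSpace_holds ℂ (m + 1)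
  have hXP : IsSmoothProjective (3 * (m + 1)) (X ⊗ projectiveSpace (m + 1) ℂ) := by
    rw [show 3 * (m + 1) = 2 * (m + 1) + (m + 1) by ring]
    exact IsSmoothProjective.tensor_holds hX hP
  exact ⟨X ⊗ projectiveSpace (m + 1) ℂ, hXP, lift (𝟙 X) (toUnit X ≫ y), fst X _, lift_fst _ _⟩

/-- **Under the Hodge conjecture the shadow kernel is zero** (so the bet `ShadowKernelEnveloped` of
line `Sketch` is HC-vacuous — true by `γ = 0` — and its hypothesis is non-trivially satisfiable only
in a world where HC fails): the retract hull `X ⊗ ℙ^{m+1}` is admissible under HC.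
[cite: Deligne2000, §1] -/
theorem shadowKernel_eq_zero_of_hodgeConjecture (hHC : _root_.HodgeConjecture) (μ : OrientationFamily)
    (hX : IsSmoothProjective (2 * (m + 1)) X) {e : complexBetti X (2 * (m + 1))}
    (hsh : ∀ (X' : SchemeOver ℂ) (hX' : IsSmoothProjective (3 * (m + 1)) X') (ι : X ⟶ X'),
      (∀ a : complexBetti X' (2 * (m + 1)), IsRationalClass a →
        IsOfHodgeType (3 * (m + 1)) X' (2 * (m + 1)) (m + 1) (m + 1) a →
        a ∈ algebraicClasses X' (m + 1)) →
      complexGysin μ hX hX' ι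
        (show 2 * (m + 1) + 2 * (3 * (m + 1)) = 2 * (2 * (m + 1)) + 2 * (2 * (m + 1)) by ring) e = 0) :
    e = 0 := by
  obtain ⟨X', hX', ι, r, hιr⟩ := exists_product_retract hX
  exact shadowKernel_eq_zero_of_admissible_retract μ hX hsh X' hX' ι r hιr
    fun a ha hH ↦ (hHC hX').2 (m + 1) a ha hH

/-- **Contrapositive, the line-level ceiling**: a non-zero class in the shadow kernel of some smooth
projective `2(m+1)`-fold refutes the Hodge conjecture. [cite: Deligne2000, §1] -/
theorem not_hodgeConjecture_of_shadowKernel_ne_zero (μ : OrientationFamily)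
    (hX : IsSmoothProjective (2 * (m + 1)) X) {e : complexBetti X (2 * (m + 1))} (he : e ≠ 0)
    (hsh : ∀ (X' : SchemeOver ℂ) (hX' : IsSmoothProjective (3 * (m + 1)) X') (ι : X ⟶ X'),
      (∀ a : complexBetti X' (2 * (m + 1)), IsRationalClass a →
        IsOfHodgeType (3 * (m + 1)) X' (2 * (m + 1)) (m + 1) (m + 1) a →
        a ∈ algebraicClasses X' (m + 1)) →
      complexGysin μ hX hX' ι
        (show 2 * (m + 1) + 2 * (3 * (m + 1)) = 2 * (2 * (m + 1)) + 2 * (2 * (m + 1)) by ring) e = 0) :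
    ¬ _root_.HodgeConjecture :=
  fun hHC ↦ he (shadowKernel_eq_zero_of_hodgeConjecture hHC μ hX hsh)

end Summit.HodgeConjecture.HodgeConjecture.Theorems.AlgebraicOrEnveloped.Negative.Calibration

end
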